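/- Width seat `ym-line-cbag-p1-w3` (prover-ym-line-cbag-p1-w3-g0-0), route `ColdBoxAllGroups`, crux `BoxFloorAllGroups`
(stmt-QuantumFields-22254), line `birth`, lead's PLAN v5: brick B9c «ExponentsG», part 2 (the window and the five error terms, eventually). -/
import Summits.QuantumFields.YangMills.Theorems.ColdBoxAllGroupsBoxFloorAllGroupsExponentsGPrelims

/-!
# Crux `BoxFloorAllGroups`, stub S2, brick B9c «ExponentsG», part 2: the one-scale WINDOW holds eventually and every error term of the
# core bound (B9a «CoreG») is eventually `≤ β^{−9θ}/5` (`0 < θ ≤ 1/100`, `ε = 3θ`, constants symbolic in `N, D, C₂`)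

With `H = ⌈β^θ⌉`, the link radius `m = 2(12H²+2H+1)·√2·√(β^{6θ−1})`, the Gaussian radius `R = β^{3θ}/(2(√D+1))`, the Gaussian chart bound
`m_E = √D(12H²+2H+1)R/√β`, the bad mass `p = 240·D·(2H+1)⁴e^{−R²/2}`, `M = β^{6θ}`, `τ = 190βm³`, `ℓ = 2C₂m²`, `w = 120(2H+1)⁴τ + 4(2H+1)⁴ℓ`:
* `eventually_hwin` — `(D/2)R²/β + 190·m_E³ < β^{6θ−1}`; `eventually_badMass_lt_one` — `p < 1`;
* `eventually_T1_le` (`β²·24N²e^{−β^{3θ}}`), `eventually_T2_le` (`3M²(e^{2w}−1)`), `eventually_T3_le` (`6M²p`), `eventually_T4_le` (`2τ(M+D)`),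
  `eventually_T5_le` (`√p(2MD+3D²+D²)`): each eventually `≤ β^{−9θ}/5`;
* **`eventually_oneScale_windowG`** — all of the above together with `m ≤ κ` (any `κ > 0`), `m_E ≤ m`, `m_E ≤ 1/4`, in one `∀ᶠ β in atTop`.
Only `θ ≤ 1/100` (`40θ < 1/2`) is used.  No sorry; no definition; standard axioms.  NOT a claim about the mass gap (rung-level support, RECORD label).
-/

set_option autoImplicit false

noncomputable section

open Filter Topology Finset Real

namespace Summit.QuantumFields.YangMills.Theorems.ColdBoxAllGroups

open Summit.QuantumFields.YangMills.Theorems.WeakCouplingRates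

/-! ## The window -/

/-- **Window: the cubic Gaussian window holds eventually**: `(D/2)R²/β + 190·m_E³ < β^{6θ−1}` (`0 ≤ θ ≤ 1/100`). -/
theorem eventually_hwin (D : ℕ) {θ : ℝ} (hθ : 0 ≤ θ) (hθ1 : θ ≤ 1 / 100) :
    ∀ᶠ β : ℝ in atTop,
      (D : ℝ) / 2 * (β ^ (3 * θ) / (2 * (Real.sqrt D + 1))) ^ 2 / β +
          190 * (Real.sqrt D * ((12 * (⌈β ^ θ⌉₊ : ℝ) ^ 2 + 2 * ⌈β ^ θ⌉₊ + 1) * (β ^ (3 * θ) / (2 * (Real.sqrt D + 1)))) /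
            Real.sqrt β) ^ 3 <
        β ^ (2 * (3 * θ) - 1) := by
  -- `190 (m/5)³ ≤ (190/125)(106√2)³ β^{15θ−3/2}` and `(190/125)(106√2)³(8/7)·β^{9θ−1/2} → 0`
  set K : ℝ := 106 * Real.sqrt 2 with hK
  have ht := tendsto_const_mul_rpow_of_neg (190 / 125 * K ^ 3 * (8 / 7) * 2) (s := 1 / 2 - 9 * θ) (by linarith)
  filter_upwards [eventually_le_one_of_tendsto_zero ht, eventually_ge_atTop (1 : ℝ)] with β hsmall hβ
  have hβ0 : 0 < β := by linarith
  have h1 := gaussRadius_sq_term_le D (θ := θ) hβ0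
  have hmE := mE_le_m_div D (θ := θ) hβ
  have hm3 := linkRadius_pow_le hβ hθ 3
  set m : ℝ := 2 * ((12 * (⌈β ^ θ⌉₊ : ℝ) ^ 2 + 2 * ⌈β ^ θ⌉₊ + 1) * (Real.sqrt 2 * Real.sqrt (β ^ (2 * (3 * θ) - 1)))) with hm
  set mE : ℝ := Real.sqrt D * ((12 * (⌈β ^ θ⌉₊ : ℝ) ^ 2 + 2 * ⌈β ^ θ⌉₊ + 1) * (β ^ (3 * θ) / (2 * (Real.sqrt D + 1)))) /
    Real.sqrt β with hmEdef
  have hmE0 : 0 ≤ mE := by positivity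
  have hm0 : 0 ≤ m := linkRadius_nonneg β θ
  have hmE3 : mE ^ 3 ≤ (m / 5) ^ 3 := pow_le_pow_left₀ hmE0 hmE 3
  -- the power `β^{15θ−3/2} = β^{9θ−1/2}·β^{6θ−1}`
  have hsplit : β ^ (((3 : ℕ) : ℝ) * (5 * θ - 1 / 2)) = β ^ (-(1 / 2 - 9 * θ)) * β ^ (2 * (3 * θ) - 1) := by
    rw [← Real.rpow_add hβ0]; congr 1; push_cast; ring
  have hX : 0 < β ^ (2 * (3 * θ) - 1) := Real.rpow_pos_of_pos hβ0 _
  have hcube : 190 * mE ^ 3 ≤ 7 / 8 * β ^ (2 * (3 * θ) - 1) / 2 * (190 / 125 * K ^ 3 * (8 / 7) * 2 * β ^ (-(1 / 2 - 9 * θ))) := by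
    calc 190 * mE ^ 3 ≤ 190 * (m / 5) ^ 3 := by gcongr
      _ = 190 / 125 * m ^ 3 := by ring
      _ ≤ 190 / 125 * (K ^ 3 * β ^ (((3 : ℕ) : ℝ) * (5 * θ - 1 / 2))) := by gcongr
      _ = 7 / 8 * β ^ (2 * (3 * θ) - 1) / 2 * (190 / 125 * K ^ 3 * (8 / 7) * 2 * β ^ (-(1 / 2 - 9 * θ))) := by
          rw [hsplit]; ring
  have hcube' : 190 * mE ^ 3 ≤ 7 / 8 * β ^ (2 * (3 * θ) - 1) / 2 := by
    have h0 : 0 ≤ 7 / 8 * β ^ (2 * (3 * θ) - 1) / 2 := by positivity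
    calc 190 * mE ^ 3 ≤ 7 / 8 * β ^ (2 * (3 * θ) - 1) / 2 * (190 / 125 * K ^ 3 * (8 / 7) * 2 * β ^ (-(1 / 2 - 9 * θ))) := hcube
      _ ≤ 7 / 8 * β ^ (2 * (3 * θ) - 1) / 2 * 1 := mul_le_mul_of_nonneg_left hsmall h0
      _ = 7 / 8 * β ^ (2 * (3 * θ) - 1) / 2 := mul_one _
  linarith

/-- **Window: the Gaussian bad mass is eventually `< 1`** (indeed `→ 0`). -/
theorem eventually_badMass_lt_one (D : ℕ) {θ : ℝ} (hθ : 0 < θ) :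
    ∀ᶠ β : ℝ in atTop,
      240 * (D : ℝ) * (2 * (⌈β ^ θ⌉₊ : ℝ) + 1) ^ 4 * Real.exp (-((β ^ (3 * θ) / (2 * (Real.sqrt D + 1))) ^ 2 / 2)) < 1 := by
  have hb : (0 : ℝ) < 1 / (8 * (Real.sqrt D + 1) ^ 2) := by positivity
  have ht := tendsto_const_mul_rpow_mul_exp_neg (150000 * (D : ℝ)) (4 * θ) (a := 6 * θ) (by linarith) hb
  filter_upwards [ht.eventually (gt_mem_nhds (by norm_num : (0 : ℝ) < 1)), eventually_ge_atTop (1 : ℝ)] with β hlt hβ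
  exact (badMass_le D hβ hθ.le).trans_lt hlt

/-! ## The five error terms -/

/-- **T1** (large-field conditioning): `β²·24N²e^{−β^{3θ}} ≤ β^{−9θ}/5` eventually. -/
theorem eventually_T1_le (N : ℝ) {θ : ℝ} (hθ : 0 < θ) :
    ∀ᶠ β : ℝ in atTop, β ^ 2 * (24 * N ^ 2 * Real.exp (-(β ^ (3 * θ)))) ≤ β ^ (-(9 * θ)) / 5 := by
  refine eventually_le_target_of_le_rpow_mul_exp (C := 24 * N ^ 2) (s := 2) (a := 3 * θ) (b := 1) (by linarith) one_pos ?_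
  intro β hβ
  have hβ0 : 0 < β := by linarith
  rw [one_mul, ← Real.rpow_natCast β 2]
  push_cast
  exact le_of_eq (by ring)

/-- **T3** (Gaussian bad event): `6M²p ≤ β^{−9θ}/5` eventually. -/
theorem eventually_T3_le (D : ℕ) {θ : ℝ} (hθ : 0 < θ) :
    ∀ᶠ β : ℝ in atTop,
      6 * (β ^ (2 * (3 * θ))) ^ 2 *
          (240 * (D : ℝ) * (2 * (⌈β ^ θ⌉₊ : ℝ) + 1) ^ 4 * Real.exp (-((β ^ (3 * θ) / (2 * (Real.sqrt D + 1))) ^ 2 / 2))) ≤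
        β ^ (-(9 * θ)) / 5 := by
  have hb : (0 : ℝ) < 1 / (8 * (Real.sqrt D + 1) ^ 2) := by positivity
  refine eventually_le_target_of_le_rpow_mul_exp (C := 6 * (150000 * (D : ℝ))) (s := 12 * θ + 4 * θ) (a := 6 * θ)
    (b := 1 / (8 * (Real.sqrt D + 1) ^ 2)) (by linarith) hb ?_
  intro β hβ
  have hβ0 : 0 < β := by linarith
  have hp := badMass_le D hβ hθ.le
  have hM : (β ^ (2 * (3 * θ))) ^ 2 = β ^ (12 * θ) := by
    rw [← Real.rpow_natCast, ← Real.rpow_mul hβ0.le]; congr 1; push_cast; ring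
  rw [hM]
  have hM0 : 0 ≤ 6 * β ^ (12 * θ) := by positivity
  calc 6 * β ^ (12 * θ) * (240 * (D : ℝ) * (2 * (⌈β ^ θ⌉₊ : ℝ) + 1) ^ 4 *
        Real.exp (-((β ^ (3 * θ) / (2 * (Real.sqrt D + 1))) ^ 2 / 2)))
      ≤ 6 * β ^ (12 * θ) * (150000 * (D : ℝ) * β ^ (4 * θ) * Real.exp (-(1 / (8 * (Real.sqrt D + 1) ^ 2) * β ^ (6 * θ)))) :=
        mul_le_mul_of_nonneg_left hp hM0
    _ = 6 * (150000 * (D : ℝ)) * (β ^ (12 * θ) * β ^ (4 * θ)) * Real.exp (-(1 / (8 * (Real.sqrt D + 1) ^ 2) * β ^ (6 * θ))) := by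
        ring
    _ = _ := by rw [← Real.rpow_add hβ0]

/-- **T4** (cubic remainder): `2τ(M + D) ≤ β^{−9θ}/5` eventually (`τ = 190βm³`). -/
theorem eventually_T4_le (D : ℕ) {θ : ℝ} (hθ : 0 ≤ θ) (hθ1 : θ ≤ 1 / 100) :
    ∀ᶠ β : ℝ in atTop,
      2 * (190 * β * (2 * ((12 * (⌈β ^ θ⌉₊ : ℝ) ^ 2 + 2 * ⌈β ^ θ⌉₊ + 1) * (Real.sqrt 2 * Real.sqrt (β ^ (2 * (3 * θ) - 1))))) ^ 3) *
          (β ^ (2 * (3 * θ)) + D) ≤ β ^ (-(9 * θ)) / 5 := by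
  set K : ℝ := 106 * Real.sqrt 2 with hK
  refine eventually_le_target_of_le_rpow (C := 380 * K ^ 3 * (1 + D)) (s := 21 * θ - 1 / 2) (by linarith) ?_
  intro β hβ
  have hβ0 : 0 < β := by linarith
  have hm3 := linkRadius_pow_le hβ hθ 3
  set m : ℝ := 2 * ((12 * (⌈β ^ θ⌉₊ : ℝ) ^ 2 + 2 * ⌈β ^ θ⌉₊ + 1) * (Real.sqrt 2 * Real.sqrt (β ^ (2 * (3 * θ) - 1)))) with hm
  have hM1 : 1 ≤ β ^ (2 * (3 * θ)) := Real.one_le_rpow hβ (by linarith)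
  have hD : (0 : ℝ) ≤ D := Nat.cast_nonneg _
  have hMD : β ^ (2 * (3 * θ)) + D ≤ (1 + D) * β ^ (2 * (3 * θ)) := by nlinarith
  have hpow : β * β ^ (((3 : ℕ) : ℝ) * (5 * θ - 1 / 2)) * β ^ (2 * (3 * θ)) = β ^ (21 * θ - 1 / 2) := by
    rw [show β * β ^ (((3 : ℕ) : ℝ) * (5 * θ - 1 / 2)) = β ^ (1 : ℝ) * β ^ (((3 : ℕ) : ℝ) * (5 * θ - 1 / 2)) by rw [Real.rpow_one],
      ← Real.rpow_add hβ0, ← Real.rpow_add hβ0]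
    congr 1; push_cast; ring
  have h0 : 0 ≤ 2 * (190 * β * m ^ 3) := by positivity
  calc 2 * (190 * β * m ^ 3) * (β ^ (2 * (3 * θ)) + D)
      ≤ 2 * (190 * β * m ^ 3) * ((1 + D) * β ^ (2 * (3 * θ))) := mul_le_mul_of_nonneg_left hMD h0
    _ ≤ 2 * (190 * β * (K ^ 3 * β ^ (((3 : ℕ) : ℝ) * (5 * θ - 1 / 2)))) * ((1 + D) * β ^ (2 * (3 * θ))) := by gcongr
    _ = 380 * K ^ 3 * (1 + D) * (β * β ^ (((3 : ℕ) : ℝ) * (5 * θ - 1 / 2)) * β ^ (2 * (3 * θ))) := by ring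
    _ = 380 * K ^ 3 * (1 + D) * β ^ (21 * θ - 1 / 2) := by rw [hpow]

/-- **T5** (Cauchy–Schwarz on the bad event): `√p·(2MD + 3D² + D²) ≤ β^{−9θ}/5` eventually. -/
theorem eventually_T5_le (D : ℕ) {θ : ℝ} (hθ : 0 < θ) :
    ∀ᶠ β : ℝ in atTop,
      Real.sqrt (240 * (D : ℝ) * (2 * (⌈β ^ θ⌉₊ : ℝ) + 1) ^ 4 * Real.exp (-((β ^ (3 * θ) / (2 * (Real.sqrt D + 1))) ^ 2 / 2))) *
          (2 * β ^ (2 * (3 * θ)) * D + 3 * (D : ℝ) ^ 2 + (D : ℝ) ^ 2) ≤ β ^ (-(9 * θ)) / 5 := by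
  have hb : (0 : ℝ) < 1 / (16 * (Real.sqrt D + 1) ^ 2) := by positivity
  refine eventually_le_target_of_le_rpow_mul_exp (C := Real.sqrt (150000 * (D : ℝ)) * (2 * D + 4 * (D : ℝ) ^ 2))
    (s := 2 * θ + 2 * (3 * θ)) (a := 6 * θ) (b := 1 / (16 * (Real.sqrt D + 1) ^ 2)) (by linarith) hb ?_
  intro β hβ
  have hβ0 : 0 < β := by linarith
  have hs := sqrt_badMass_le D hβ hθ.le
  have hM1 : 1 ≤ β ^ (2 * (3 * θ)) := Real.one_le_rpow hβ (by linarith)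
  have hD : (0 : ℝ) ≤ D := Nat.cast_nonneg _
  have hpoly : 2 * β ^ (2 * (3 * θ)) * D + 3 * (D : ℝ) ^ 2 + (D : ℝ) ^ 2 ≤ (2 * D + 4 * (D : ℝ) ^ 2) * β ^ (2 * (3 * θ)) := by
    nlinarith
  have hpoly0 : 0 ≤ 2 * β ^ (2 * (3 * θ)) * D + 3 * (D : ℝ) ^ 2 + (D : ℝ) ^ 2 := by positivity
  have h0 : 0 ≤ Real.sqrt (150000 * (D : ℝ)) * β ^ (2 * θ) * Real.exp (-(1 / (16 * (Real.sqrt D + 1) ^ 2) * β ^ (6 * θ))) := by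
    positivity
  calc Real.sqrt (240 * (D : ℝ) * (2 * (⌈β ^ θ⌉₊ : ℝ) + 1) ^ 4 * Real.exp (-((β ^ (3 * θ) / (2 * (Real.sqrt D + 1))) ^ 2 / 2))) *
        (2 * β ^ (2 * (3 * θ)) * D + 3 * (D : ℝ) ^ 2 + (D : ℝ) ^ 2)
      ≤ (Real.sqrt (150000 * (D : ℝ)) * β ^ (2 * θ) * Real.exp (-(1 / (16 * (Real.sqrt D + 1) ^ 2) * β ^ (6 * θ)))) *
          ((2 * D + 4 * (D : ℝ) ^ 2) * β ^ (2 * (3 * θ))) := mul_le_mul hs hpoly hpoly0 h0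
    _ = Real.sqrt (150000 * (D : ℝ)) * (2 * D + 4 * (D : ℝ) ^ 2) * (β ^ (2 * θ) * β ^ (2 * (3 * θ))) *
          Real.exp (-(1 / (16 * (Real.sqrt D + 1) ^ 2) * β ^ (6 * θ))) := by ring
    _ = _ := by rw [← Real.rpow_add hβ0]

/-- The tilt exponent bound: `w = 120(2H+1)⁴τ + 4(2H+1)⁴ℓ ≤ A₁β^{19θ−1/2} + A₂β^{14θ−1}` for `β ≥ 1`
(`A₁ = 120·625·190·(106√2)³`, `A₂ = 4·625·2C₂·(106√2)²`, `C₂ ≥ 0`). -/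
theorem tiltExponent_le {C₂ : ℝ} (hC₂ : 0 ≤ C₂) {β θ : ℝ} (hβ : 1 ≤ β) (hθ : 0 ≤ θ) :
    120 * (2 * (⌈β ^ θ⌉₊ : ℝ) + 1) ^ 4 *
          (190 * β * (2 * ((12 * (⌈β ^ θ⌉₊ : ℝ) ^ 2 + 2 * ⌈β ^ θ⌉₊ + 1) * (Real.sqrt 2 * Real.sqrt (β ^ (2 * (3 * θ) - 1))))) ^ 3) +
        4 * (2 * (⌈β ^ θ⌉₊ : ℝ) + 1) ^ 4 *
          (2 * C₂ * (2 * ((12 * (⌈β ^ θ⌉₊ : ℝ) ^ 2 + 2 * ⌈β ^ θ⌉₊ + 1) * (Real.sqrt 2 * Real.sqrt (β ^ (2 * (3 * θ) - 1))))) ^ 2) ≤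
      120 * 625 * 190 * (106 * Real.sqrt 2) ^ 3 * β ^ (19 * θ - 1 / 2) + 4 * 625 * (2 * C₂) * (106 * Real.sqrt 2) ^ 2 * β ^ (14 * θ - 1) := by
  have hβ0 : 0 < β := by linarith
  set K : ℝ := 106 * Real.sqrt 2 with hK
  set m : ℝ := 2 * ((12 * (⌈β ^ θ⌉₊ : ℝ) ^ 2 + 2 * ⌈β ^ θ⌉₊ + 1) * (Real.sqrt 2 * Real.sqrt (β ^ (2 * (3 * θ) - 1)))) with hm
  have hm3 := linkRadius_pow_le hβ hθ 3
  have hm2 := linkRadius_pow_le hβ hθ 2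
  have h4 := twoH_pow_four_le hβ hθ
  have e1 : β ^ (4 * θ) * (β * β ^ (((3 : ℕ) : ℝ) * (5 * θ - 1 / 2))) = β ^ (19 * θ - 1 / 2) := by
    rw [show β * β ^ (((3 : ℕ) : ℝ) * (5 * θ - 1 / 2)) = β ^ (1 : ℝ) * β ^ (((3 : ℕ) : ℝ) * (5 * θ - 1 / 2)) by rw [Real.rpow_one],
      ← Real.rpow_add hβ0, ← Real.rpow_add hβ0]
    congr 1; push_cast; ring
  have e2 : β ^ (4 * θ) * β ^ (((2 : ℕ) : ℝ) * (5 * θ - 1 / 2)) = β ^ (14 * θ - 1) := by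
    rw [← Real.rpow_add hβ0]; congr 1; push_cast; ring
  have hA : 120 * (2 * (⌈β ^ θ⌉₊ : ℝ) + 1) ^ 4 * (190 * β * m ^ 3) ≤ 120 * 625 * 190 * K ^ 3 * β ^ (19 * θ - 1 / 2) := by
    calc 120 * (2 * (⌈β ^ θ⌉₊ : ℝ) + 1) ^ 4 * (190 * β * m ^ 3)
        ≤ 120 * (625 * β ^ (4 * θ)) * (190 * β * (K ^ 3 * β ^ (((3 : ℕ) : ℝ) * (5 * θ - 1 / 2)))) := by gcongr
      _ = 120 * 625 * 190 * K ^ 3 * (β ^ (4 * θ) * (β * β ^ (((3 : ℕ) : ℝ) * (5 * θ - 1 / 2)))) := by ring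
      _ = _ := by rw [e1]
  have hB : 4 * (2 * (⌈β ^ θ⌉₊ : ℝ) + 1) ^ 4 * (2 * C₂ * m ^ 2) ≤ 4 * 625 * (2 * C₂) * K ^ 2 * β ^ (14 * θ - 1) := by
    calc 4 * (2 * (⌈β ^ θ⌉₊ : ℝ) + 1) ^ 4 * (2 * C₂ * m ^ 2)
        ≤ 4 * (625 * β ^ (4 * θ)) * (2 * C₂ * (K ^ 2 * β ^ (((2 : ℕ) : ℝ) * (5 * θ - 1 / 2)))) := by gcongr
      _ = 4 * 625 * (2 * C₂) * K ^ 2 * (β ^ (4 * θ) * β ^ (((2 : ℕ) : ℝ) * (5 * θ - 1 / 2))) := by ring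
      _ = _ := by rw [e2]
  exact add_le_add hA hB

/-- **T2** (tilt): `3M²(e^{2w} − 1) ≤ β^{−9θ}/5` eventually (`w` the tilt exponent bound with the card bounds `120(2H+1)⁴`, `4(2H+1)⁴`). -/
theorem eventually_T2_le {C₂ : ℝ} (hC₂ : 0 ≤ C₂) {θ : ℝ} (hθ : 0 ≤ θ) (hθ1 : θ ≤ 1 / 100) :
    ∀ᶠ β : ℝ in atTop,
      3 * (β ^ (2 * (3 * θ))) ^ 2 * (Real.exp (2 *
          (120 * (2 * (⌈β ^ θ⌉₊ : ℝ) + 1) ^ 4 *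
              (190 * β * (2 * ((12 * (⌈β ^ θ⌉₊ : ℝ) ^ 2 + 2 * ⌈β ^ θ⌉₊ + 1) * (Real.sqrt 2 * Real.sqrt (β ^ (2 * (3 * θ) - 1))))) ^ 3) +
            4 * (2 * (⌈β ^ θ⌉₊ : ℝ) + 1) ^ 4 *
              (2 * C₂ * (2 * ((12 * (⌈β ^ θ⌉₊ : ℝ) ^ 2 + 2 * ⌈β ^ θ⌉₊ + 1) * (Real.sqrt 2 * Real.sqrt (β ^ (2 * (3 * θ) - 1))))) ^ 2))) - 1) ≤
        β ^ (-(9 * θ)) / 5 := by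
  set A₁ : ℝ := 120 * 625 * 190 * (106 * Real.sqrt 2) ^ 3 with hA₁
  set A₂ : ℝ := 4 * 625 * (2 * C₂) * (106 * Real.sqrt 2) ^ 2 with hA₂
  have hA₁0 : 0 ≤ A₁ := by positivity
  have hA₂0 : 0 ≤ A₂ := by positivity
  -- the two majorants `12·M²·Aᵢβ^{…}`, doubled, are eventually below the target; and `w ≤ 1/2`
  have h1 := eventually_le_target_of_le_rpow (θ := θ) (C := 2 * (12 * A₁)) (s := 31 * θ - 1 / 2)
    (f := fun β => 2 * (12 * A₁ * β ^ (31 * θ - 1 / 2))) (by linarith) (fun β _ => le_of_eq (by ring))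
  have h2 := eventually_le_target_of_le_rpow (θ := θ) (C := 2 * (12 * A₂)) (s := 26 * θ - 1)
    (f := fun β => 2 * (12 * A₂ * β ^ (26 * θ - 1))) (by linarith) (fun β _ => le_of_eq (by ring))
  have h3 := eventually_le_target_of_le_rpow (θ := θ) (C := 4 * A₁) (s := 19 * θ - 1 / 2)
    (f := fun β => 4 * (A₁ * β ^ (19 * θ - 1 / 2))) (by linarith) (fun β _ => le_of_eq (by ring))
  have h4 := eventually_le_target_of_le_rpow (θ := θ) (C := 4 * A₂) (s := 14 * θ - 1)
    (f := fun β => 4 * (A₂ * β ^ (14 * θ - 1))) (by linarith) (fun β _ => le_of_eq (by ring))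
  filter_upwards [h1, h2, h3, h4, eventually_ge_atTop (1 : ℝ)] with β hβ1 hβ2 hβ3 hβ4 hβ
  have hβ0 : 0 < β := by linarith
  have htar : β ^ (-(9 * θ)) / 5 ≤ 1 / 5 := by
    have : β ^ (-(9 * θ)) ≤ 1 := Real.rpow_le_one_of_one_le_of_nonpos hβ (by linarith)
    linarith
  set w : ℝ := 120 * (2 * (⌈β ^ θ⌉₊ : ℝ) + 1) ^ 4 *
      (190 * β * (2 * ((12 * (⌈β ^ θ⌉₊ : ℝ) ^ 2 + 2 * ⌈β ^ θ⌉₊ + 1) * (Real.sqrt 2 * Real.sqrt (β ^ (2 * (3 * θ) - 1))))) ^ 3) +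
    4 * (2 * (⌈β ^ θ⌉₊ : ℝ) + 1) ^ 4 *
      (2 * C₂ * (2 * ((12 * (⌈β ^ θ⌉₊ : ℝ) ^ 2 + 2 * ⌈β ^ θ⌉₊ + 1) * (Real.sqrt 2 * Real.sqrt (β ^ (2 * (3 * θ) - 1))))) ^ 2) with hw
  have hw0 : 0 ≤ w := by positivity
  have hwle : w ≤ A₁ * β ^ (19 * θ - 1 / 2) + A₂ * β ^ (14 * θ - 1) := tiltExponent_le hC₂ hβ hθ
  have hwhalf : w ≤ 1 / 2 := by
    have : 4 * (A₁ * β ^ (19 * θ - 1 / 2)) + 4 * (A₂ * β ^ (14 * θ - 1)) ≤ 2 / 5 := by linarith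
    linarith
  -- `e^{2w} − 1 ≤ 4w`
  have hexp : Real.exp (2 * w) - 1 ≤ 4 * w := by
    have h := Real.abs_exp_sub_one_le (x := 2 * w) (by rw [abs_of_nonneg (by positivity)]; linarith)
    rw [abs_of_nonneg (by positivity : (0 : ℝ) ≤ 2 * w)] at h
    linarith [le_abs_self (Real.exp (2 * w) - 1)]
  have hM : (β ^ (2 * (3 * θ))) ^ 2 = β ^ (12 * θ) := by
    rw [← Real.rpow_natCast, ← Real.rpow_mul hβ0.le]; congr 1; push_cast; ring
  have e31 : β ^ (12 * θ) * β ^ (19 * θ - 1 / 2) = β ^ (31 * θ - 1 / 2) := by rw [← Real.rpow_add hβ0]; congr 1; ring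
  have e26 : β ^ (12 * θ) * β ^ (14 * θ - 1) = β ^ (26 * θ - 1) := by rw [← Real.rpow_add hβ0]; congr 1; ring
  rw [hM]
  have hM0 : 0 ≤ 3 * β ^ (12 * θ) := by positivity
  calc 3 * β ^ (12 * θ) * (Real.exp (2 * w) - 1) ≤ 3 * β ^ (12 * θ) * (4 * w) := mul_le_mul_of_nonneg_left hexp hM0
    _ ≤ 3 * β ^ (12 * θ) * (4 * (A₁ * β ^ (19 * θ - 1 / 2) + A₂ * β ^ (14 * θ - 1))) := by gcongr
    _ = 12 * A₁ * (β ^ (12 * θ) * β ^ (19 * θ - 1 / 2)) + 12 * A₂ * (β ^ (12 * θ) * β ^ (14 * θ - 1)) := by ring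
    _ = 12 * A₁ * β ^ (31 * θ - 1 / 2) + 12 * A₂ * β ^ (26 * θ - 1) := by rw [e31, e26]
    _ ≤ β ^ (-(9 * θ)) / 5 := by linarith

/-! ## The lead's statement, verbatim (crux dir `Lines/ExponentsG_stmt.lean`) -/

/-- The two spellings of the Gaussian exponent agree: `-(R)^2/2 = -(R^2/2)`. -/
theorem exp_neg_sq_div_two_eq (R : ℝ) : Real.exp (-R ^ 2 / 2) = Real.exp (-(R ^ 2 / 2)) := by
  congr 1; ring

/-- **B9c «ExponentsG» (the lead's statement, verbatim).**  The one-scale window of the `G`-generic expansion at `ε = 3θ`, link radius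
`m = 2η_β`, Gaussian radius `R = β^{3θ}/(2(√D+1))`, and the final smallness `RHS(β) ≤ β^{−9θ}` of brick B9a «CoreG», hold eventually in
`β` for every `0 < θ ≤ 1/100` and all constants `N, D, r₂, C₂`. -/
theorem eventually_oneScale_boundsG (N D : ℕ) {θ r₂ C₂ : ℝ} (hθ : 0 < θ) (hθ1 : θ ≤ 1 / 100) (hr₂ : 0 < r₂) (hC₂ : 0 < C₂) :
    ∀ᶠ β : ℝ in atTop, 1 ≤ β ∧
      -- (2) link radius m = 2η ≤ 1/4 and ≤ r₂, and C₂ m² ≤ 1/2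
      2 * ((12 * (⌈β ^ θ⌉₊ : ℝ) ^ 2 + 2 * ⌈β ^ θ⌉₊ + 1) * (Real.sqrt 2 * Real.sqrt (β ^ (2 * (3 * θ) - 1)))) ≤ 1 / 4 ∧
      2 * ((12 * (⌈β ^ θ⌉₊ : ℝ) ^ 2 + 2 * ⌈β ^ θ⌉₊ + 1) * (Real.sqrt 2 * Real.sqrt (β ^ (2 * (3 * θ) - 1)))) ≤ r₂ ∧
      -- (3) Gaussian link radius mE ≤ m
      Real.sqrt D * ((12 * (⌈β ^ θ⌉₊ : ℝ) ^ 2 + 2 * ⌈β ^ θ⌉₊ + 1) * (β ^ (3 * θ) / (2 * (Real.sqrt D + 1)))) / Real.sqrt β ≤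
        2 * ((12 * (⌈β ^ θ⌉₊ : ℝ) ^ 2 + 2 * ⌈β ^ θ⌉₊ + 1) * (Real.sqrt 2 * Real.sqrt (β ^ (2 * (3 * θ) - 1)))) ∧
      -- (4) Gaussian window
      (D : ℝ) / 2 * (β ^ (3 * θ) / (2 * (Real.sqrt D + 1))) ^ 2 / β +
          190 * (Real.sqrt D * ((12 * (⌈β ^ θ⌉₊ : ℝ) ^ 2 + 2 * ⌈β ^ θ⌉₊ + 1) * (β ^ (3 * θ) / (2 * (Real.sqrt D + 1)))) / Real.sqrt β) ^ 3 <
        β ^ (2 * (3 * θ) - 1) ∧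
      -- (5) Gaussian bad mass p < 1
      240 * (D : ℝ) * (2 * (⌈β ^ θ⌉₊ : ℝ) + 1) ^ 4 * Real.exp (-(β ^ (3 * θ) / (2 * (Real.sqrt D + 1))) ^ 2 / 2) < 1 ∧
      -- (6) the final bound of CoreG with w replaced by its card upper bound is ≤ β^{-9θ}
      β ^ 2 * (24 * (N : ℝ) ^ 2 * Real.exp (-(β ^ (3 * θ)))) +
          3 * (β ^ (2 * (3 * θ))) ^ 2 * (Real.exp (2 * ((120 * (2 * (⌈β ^ θ⌉₊ : ℝ) + 1) ^ 4) *
              (190 * β * (2 * ((12 * (⌈β ^ θ⌉₊ : ℝ) ^ 2 + 2 * ⌈β ^ θ⌉₊ + 1) * (Real.sqrt 2 * Real.sqrt (β ^ (2 * (3 * θ) - 1))))) ^ 3) +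
            (4 * (2 * (⌈β ^ θ⌉₊ : ℝ) + 1) ^ 4) *
              (2 * C₂ * (2 * ((12 * (⌈β ^ θ⌉₊ : ℝ) ^ 2 + 2 * ⌈β ^ θ⌉₊ + 1) * (Real.sqrt 2 * Real.sqrt (β ^ (2 * (3 * θ) - 1))))) ^ 2))) - 1) +
          6 * (β ^ (2 * (3 * θ))) ^ 2 * (240 * (D : ℝ) * (2 * (⌈β ^ θ⌉₊ : ℝ) + 1) ^ 4 * Real.exp (-(β ^ (3 * θ) / (2 * (Real.sqrt D + 1))) ^ 2 / 2)) +
          2 * (190 * β * (2 * ((12 * (⌈β ^ θ⌉₊ : ℝ) ^ 2 + 2 * ⌈β ^ θ⌉₊ + 1) * (Real.sqrt 2 * Real.sqrt (β ^ (2 * (3 * θ) - 1))))) ^ 3) *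
            (β ^ (2 * (3 * θ)) + D) +
          Real.sqrt (240 * (D : ℝ) * (2 * (⌈β ^ θ⌉₊ : ℝ) + 1) ^ 4 * Real.exp (-(β ^ (3 * θ) / (2 * (Real.sqrt D + 1))) ^ 2 / 2)) *
            (2 * β ^ (2 * (3 * θ)) * D + 3 * (D : ℝ) ^ 2 + (D : ℝ) ^ 2) ≤
        β ^ (-(9 * θ)) := by
  filter_upwards [eventually_ge_atTop (1 : ℝ), eventually_m_le hθ.le hθ1 (by norm_num : (0 : ℝ) < 1 / 4), eventually_m_le hθ.le hθ1 hr₂,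
    eventually_hwin D hθ.le hθ1, eventually_badMass_lt_one D hθ, eventually_T1_le (N : ℝ) hθ, eventually_T2_le hC₂.le hθ.le hθ1,
    eventually_T3_le D hθ, eventually_T4_le D hθ.le hθ1, eventually_T5_le D hθ]
    with β hβ hm4 hmr hwin hp hT1 hT2 hT3 hT4 hT5
  rw [exp_neg_sq_div_two_eq]
  refine ⟨hβ, hm4, hmr, ?_, hwin, hp, ?_⟩
  · exact (mE_le_m_div D (θ := θ) hβ).trans (by linarith [linkRadius_nonneg β θ])
  · linarith

end Summit.QuantumFields.YangMills.Theorems.ColdBoxAllGroups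

end
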